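import Literature.NumberTheory.LFunctions.TruncatedWeilFormTailOrderProofs
import HarnessLib

/-!
# RH-FREE — «nothing here bears on the truth of RH»: the SOURCE side of Groskin's finite Guinand–Weil
# dictionary (arXiv:2607.02828v3, Theorem 2.5, proof p. 6): the prime side and the pole side, PROVED

Topic `Literature/NumberTheory/LFunctions` (namespace `Literature.NumberTheory.LFunctions.Groskin2026`).
Proofs only (no named facts, no `def`s), over the statement file `TruncatedWeilFormTailOrder.lean`
(rh-lit-frontier-1, p461241) and rh-lit-frontier-1's `TruncatedWeilFormTailOrderProofs.lean`
(`lemma_2_3_holds`, consumed BY NAME).  Cell rh-crit (cc-t9 g4, surplus seat on the W-C/W-P rung;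
ledger claim `Groskin2026.theorem_2_5'`): stages (P) and (Q) of the discharge of the claim
`Groskin2026.theorem_2_5'` (the explicit-formula side); stage (A) (archimedean side at finite `T`) and
the door over `lemma_2_1_limit` / `lemma_2_2` are NOT in this file.

Source: A. Groskin, *A finite Guinand–Weil dictionary and archimedean tail order for the truncated Weil
quadratic form*, arXiv:2607.02828v3 (UNREFEREED, D-0012: `[claim: Groskin2026, status: under-review]`;
a kernel proof VERIFIES the finite identities below, it asserts nothing on authority), proof of
Theorem 2.5, p. 6 (materialised text `paper:arxiv-2607.02828` p0006.txt:L40–L62, OPENED): «Lemma 2.3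
applied to the prime source (1), whose measure places mass `−Λ(q)/√q` at `ω_q = 1 − log q/L`, gives
`⟨v, Q_prime^{(c)} v⟩ = −(1/π)Σ_{q≤c} (Λ(q)/√q) πK_v(ω_q) = −(1/π)Σ_{q≤c} (Λ(q)/√q) ĝ_v(log q/2π)`, using
`ĝ_v(ξ) = πK_v(1 − ξ/Δ)` and `log q/(2π) = Δ(1 − ω_q)`. Applied to the pole source, whose measure is the
push-forward of `2cosh(y/2) dy` under `ω = 1 − y/L`, it gives
`⟨v, Q_pole v⟩ = 2L∫₀¹ K_v(ω) cosh(L(1−ω)/2) dω = ∫_{−Δ}^{Δ} ĝ_v(ξ) 2e^{−πξ} dξ = 2g_v(i/2)`, where the middle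
equality is the substitution `ξ = Δ(1−ω)` together with `πΔ = L/2`, `ĝ_v(ξ) = πK_v(1−ξ/Δ)`, and the
evenness of `ĝ_v` …, and the last equality is `e^{2πi(i/2)ξ} = e^{−πξ}`.»

LINE 1 — LABEL: **RH-FREE** (finite trigonometric / Fourier calculus at fixed `(c, N)` for the
Connes–van Suijlekom divided-difference matrices; `ζ` and its zeros do not occur — the ZERO side
`theorem_2_5`, i.e. the explicit formula, is not touched).  bears_on: W-C/W-P (LADDER-RH COLUMN 2, the
finite Guinand–Weil dictionary's source side).  WHAT THIS IS NOT: not Weil positivity, not a statement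
about zeros, not progress toward RH — «the paper does not prove RH, Weil positivity, a prime-location
bound» (its p. 13) and neither does a kernel replay of two displayed identities of its proof; nothing in
this file bears on the truth of the Riemann hypothesis.

## Contents (source item → declaration → status)

* Linearity of `ψ ↦ Q_ψ` over finite sums of differentiable sources and of `Q ↦ ⟨v, Qv⟩`:
  `dividedDiffMatrix_sum`, `quadValue_sum`, `quadValue_eq_sum'`; single-frequency entries
  `deriv_singleFreq'`, `dividedDiffMatrix_singleFreq_apply`; `continuous_volterraKernel`. PROVED.
* Lemma 2.3 "applied inside an integral": **`quadValue_dividedDiffMatrix_sinIntegral`** — for a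
  continuous weight `a` and `L > 0`, the source `ψ(x) = ∫₀^L a(y) sin(2π(1 − y/L)x) dy` has
  `⟨v, Q_ψ v⟩ = ∫₀^L π a(y) K_v(1 − y/L) dy` (off-diagonal entries by linearity of `∫`, the diagonal
  `ψ′(m)` by differentiation under the integral sign, the double sum by linearity). PROVED; this is the
  common engine for the pole source (here) and the archimedean source at finite `T` (stage (A), later).
* (P) prime side: `primeSource_eq_sum`, `quadValue_primeMatrix_eq_sum_volterraKernel`
  (`⟨v, Q_prime v⟩ = Σ_{q ≤ ⌊c⌋} (−Λ(q)/√q) K_v(1 − log q/L)`), `fourierWeight_log_div`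
  (`ĝ_v(log q/2π) = πK_v(1 − log q/L)` for `q ≤ c`), and **`quadValue_primeMatrix`**:
  `⟨v, Q_prime^{(c)} v⟩ = −(1/π) Σ_{q ≤ c} Λ(q) q^{−1/2} ĝ_v(log q/2π)` — VERBATIM the first summand of
  `theorem_2_5'`. PROVED.
* (Q) pole side: `poleSource_eq_sinIntegral`, `quadValue_poleMatrix_eq_integral`
  (`⟨v, Q_pole v⟩ = ∫₀^L 2cosh(y/2) K_v(1 − y/L) dy`), `fourierWeight_mul_cexp_I_half`,
  `pole_integrand_eq`, `two_mul_testFunction_I_half` (`2g_v(i/2) = ∫₀^L 2cosh(y/2)K_v(1 − y/L) dy`), and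
  **`quadValue_poleMatrix`**: `⟨v, Q_pole v⟩ = 2 g_v(i/2)` — VERBATIM the second summand of
  `theorem_2_5'`. PROVED.

## Proof route and divergences

As printed.  The "measure" language of the source (a source `ψ` as a superposition `∫ ψ_{α,ω} dμ`) is
rendered by finite sums (prime source) and by `∫₀^L … dy` with a continuous weight (pole source); the
divided-difference matrix of a superposition is the superposition of the matrices — for the diagonal this
is differentiation under the integral sign (`intervalIntegral.hasDerivAt_integral_of_dominated_loc_of_deriv_le`
with the constant-type bound `|a(y)|·2π(1 + |y|/L)`).  In (P) the band condition `|log q/2π| ≤ Δ` for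
`q ≤ ⌊c⌋` (including `q = 0, 1`, where `Λ = 0` anyway) is `log q ≤ log c`.  In (Q) the band integral
`∫_{−Δ}^{Δ}` is folded onto `[0, Δ]` by the evenness of `ξ ↦ K_v(1 − |ξ|/Δ)` and rescaled by `ξ = y/2π`
(`intervalIntegral.integral_comp_mul_left`), and `e^{−y/2} + e^{y/2} = 2cosh(y/2)` (`Complex.two_cosh`).

## References

* A. Groskin, arXiv:2607.02828v3 (2026), §2.1 eqs. (1)–(2) p. 3, Lemma 2.3 p. 5, Theorem 2.5 and its
  proof p. 6 (first two displays).
-/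

noncomputable section

open Filter Set MeasureTheory Complex Finset Matrix
open scoped Real Topology

namespace Literature.NumberTheory.LFunctions

namespace Groskin2026

/-! ### Linearity of `ψ ↦ Q_ψ` and of `Q ↦ ⟨v, Q v⟩` -/

/-- The divided-difference matrix of a finite sum of differentiable sources is the sum of the matrices.
[cite: Groskin2026, §2.1 (p. 3); Theorem 2.5 proof (p. 6)] -/
theorem dividedDiffMatrix_sum {ι : Type*} (s : Finset ι) (ψ : ι → ℝ → ℝ)
    (hψ : ∀ i ∈ s, Differentiable ℝ (ψ i)) (N : ℕ) :
    dividedDiffMatrix (fun x ↦ ∑ i ∈ s, ψ i x) N = ∑ i ∈ s, dividedDiffMatrix (ψ i) N := by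
  ext m n
  simp only [dividedDiffMatrix, Matrix.of_apply, Matrix.sum_apply]
  by_cases h : (m : ℤ) = n
  · simp only [if_pos h]
    have : (fun x ↦ ∑ i ∈ s, ψ i x) = ∑ i ∈ s, ψ i := by
      funext x; simp [Finset.sum_apply]
    rw [this, deriv_sum fun i hi ↦ (hψ i hi).differentiableAt]
  · simp only [if_neg h]
    rw [← Finset.sum_sub_distrib, Finset.sum_div]

/-- `⟨v, (Σ_i Q_i) v⟩ = Σ_i ⟨v, Q_i v⟩`. [cite: Groskin2026, §2.1 (p. 3); Theorem 2.5 proof (p. 6)] -/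
theorem quadValue_sum {ι : Type*} (s : Finset ι) (N : ℕ) (v : Fin (N + 1) → ℝ)
    (Q : ι → Matrix (idx N) (idx N) ℝ) :
    quadValue N v (∑ i ∈ s, Q i) = ∑ i ∈ s, quadValue N v (Q i) := by
  classical
  induction s using Finset.induction_on with
  | empty => simp [quadValue]
  | insert a s ha ih =>
    rw [Finset.sum_insert ha, Finset.sum_insert ha, ← ih]
    simp [quadValue, Matrix.add_mulVec, dotProduct_add]

/-! ### Stage P: the prime side -/

/-- The prime source (1) is the finite sum of the single-frequency sources `ψ_{α_q, ω_q}` with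
`α_q = −Λ(q)/√q`, `ω_q = 1 − log q/L` ("whose measure places mass `−Λ(q)/√q` at `ω_q`").
[cite: Groskin2026, Theorem 2.5 proof (p. 6)] -/
theorem primeSource_eq_sum (c : ℝ) :
    primeSource c = fun x ↦ ∑ q ∈ Finset.range (⌊c⌋₊ + 1),
      (-(ArithmeticFunction.vonMangoldt q) / Real.sqrt q) / π *
        Real.sin (2 * π * (1 - Real.log q / Real.log c) * x) := by
  funext x
  rw [primeSource, Finset.mul_sum]
  refine Finset.sum_congr rfl fun q _ ↦ ?_
  rw [show 2 * π * x * (1 - Real.log q / Real.log c) = 2 * π * (1 - Real.log q / Real.log c) * x by ring]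
  ring

/-- **`⟨v, Q_prime v⟩ = Σ_{q ≤ c} (−Λ(q)/√q) K_v(1 − log q/L)`** (Lemma 2.3 applied to the prime source).
[cite: Groskin2026, Theorem 2.5 proof (p. 6), first display] -/
theorem quadValue_primeMatrix_eq_sum_volterraKernel (c : ℝ) (N : ℕ) (v : Fin (N + 1) → ℝ) :
    ((quadValue N v (primeMatrix c N) : ℝ) : ℂ) =
      ∑ q ∈ Finset.range (⌊c⌋₊ + 1),
        ((-(ArithmeticFunction.vonMangoldt q) / Real.sqrt q : ℝ) : ℂ) *
          volterraKernel N v (1 - Real.log q / Real.log c) := by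
  have h23 := lemma_2_3_holds
  rw [primeMatrix, primeSource_eq_sum, dividedDiffMatrix_sum _ _ (fun q _ ↦ by fun_prop),
    quadValue_sum]
  push_cast
  refine Finset.sum_congr rfl fun q _ ↦ ?_
  have := h23 N v (-(ArithmeticFunction.vonMangoldt q) / Real.sqrt q) (1 - Real.log q / Real.log c)
  rw [this]
  push_cast
  ring

/-- For `q ≤ c` (`c > 1`) the prime-power frequency `log q/2π` lies in the band `[−Δ, Δ]` and
`ĝ_v(log q/2π) = π K_v(1 − log q/L)` ("using `ĝ_v(ξ) = πK_v(1 − ξ/Δ)` and `log q/(2π) = Δ(1 − ω_q)`").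
[cite: Groskin2026, Theorem 2.5 proof (p. 6)] -/
theorem fourierWeight_log_div (c : ℝ) (hc : 1 < c) (N : ℕ) (v : Fin (N + 1) → ℝ) {q : ℕ}
    (hq : q ∈ Finset.range (⌊c⌋₊ + 1)) :
    fourierWeight c N v (Real.log q / (2 * π)) = π * volterraKernel N v (1 - Real.log q / Real.log c) := by
  have hc0 : 0 < c := by linarith
  have hL : 0 < Real.log c := Real.log_pos hc
  have hq' : (q : ℝ) ≤ c := by
    have h1 : q ≤ ⌊c⌋₊ := Nat.lt_succ_iff.1 (Finset.mem_range.1 hq)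
    exact le_trans (by exact_mod_cast h1) (Nat.floor_le hc0.le)
  have hlog0 : 0 ≤ Real.log q := by
    rcases Nat.eq_zero_or_pos q with rfl | hpos
    · simp
    · exact Real.log_nonneg (by exact_mod_cast hpos)
  have hlogle : Real.log q ≤ Real.log c := by
    rcases Nat.eq_zero_or_pos q with rfl | hpos
    · simp [hL.le]
    · exact Real.log_le_log (by exact_mod_cast hpos) hq'
  have hpi : 0 < π := Real.pi_pos
  have habs : |Real.log q / (2 * π)| ≤ bandwidth c := by
    rw [abs_of_nonneg (by positivity), bandwidth]
    exact div_le_div_of_nonneg_right hlogle (by positivity)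
  rw [fourierWeight, if_pos habs, abs_of_nonneg (by positivity), bandwidth]
  congr 2
  field_simp

/-- **The prime side of Theorem 2.5: `⟨v, Q_prime^{(c)} v⟩ = −(1/π) Σ_{q ≤ c} Λ(q) q^{−1/2} ĝ_v(log q/2π)`.**
[cite: Groskin2026, Theorem 2.5 proof (p. 6), first display] -/
theorem quadValue_primeMatrix (c : ℝ) (hc : 1 < c) (N : ℕ) (v : Fin (N + 1) → ℝ) :
    ((quadValue N v (primeMatrix c N) : ℝ) : ℂ) =
      -(1 / π) * ∑ q ∈ Finset.range (⌊c⌋₊ + 1),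
          ((ArithmeticFunction.vonMangoldt q / Real.sqrt q : ℝ) : ℂ) *
            fourierWeight c N v (Real.log q / (2 * π)) := by
  rw [quadValue_primeMatrix_eq_sum_volterraKernel, Finset.mul_sum]
  refine Finset.sum_congr rfl fun q hq ↦ ?_
  rw [fourierWeight_log_div c hc N v hq]
  have hpi : (π : ℂ) ≠ 0 := by exact_mod_cast Real.pi_ne_zero
  push_cast
  field_simp

/-! ### A single-frequency source: entries -/

/-- The diagonal of `Q_{α,ω}`: `d/dx (α/π · sin(2πωx)) = 2αω cos(2πωx)`.
[cite: Groskin2026, proof of Lemma 2.3 (p. 5)] -/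
theorem deriv_singleFreq' (α ω x : ℝ) :
    deriv (fun x ↦ α / π * Real.sin (2 * π * ω * x)) x = 2 * α * ω * Real.cos (2 * π * ω * x) := by
  have h1 : HasDerivAt (fun y : ℝ ↦ 2 * π * ω * y) (2 * π * ω) x := by
    simpa using (hasDerivAt_id x).const_mul (2 * π * ω)
  have h2 : HasDerivAt (fun y : ℝ ↦ Real.sin (2 * π * ω * y))
      (Real.cos (2 * π * ω * x) * (2 * π * ω)) x := (Real.hasDerivAt_sin _).comp x h1
  have h3 := h2.const_mul (α / π)
  rw [h3.deriv]
  field_simp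

/-- The entries of the single-frequency matrix `Q_{α,ω}` in closed form.
[cite: Groskin2026, proof of Lemma 2.3 (p. 5)] -/
theorem dividedDiffMatrix_singleFreq_apply (N : ℕ) (α ω : ℝ) (m n : idx N) :
    dividedDiffMatrix (fun x ↦ α / π * Real.sin (2 * π * ω * x)) N m n =
      if (m : ℤ) = n then 2 * α * ω * Real.cos (2 * π * ω * ((m : ℤ) : ℝ))
      else (α / π * Real.sin (2 * π * ω * ((m : ℤ) : ℝ)) - α / π * Real.sin (2 * π * ω * ((n : ℤ) : ℝ))) /
        (((m : ℤ) : ℝ) - ((n : ℤ) : ℝ)) := by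
  unfold dividedDiffMatrix
  simp only [Matrix.of_apply]
  by_cases h : (m : ℤ) = n
  · rw [if_pos h, if_pos h, deriv_singleFreq']
  · rw [if_neg h, if_neg h]

/-- `⟨v, Q v⟩` as a double sum. [cite: Groskin2026, §2.1 (p. 3)] -/
theorem quadValue_eq_sum' (N : ℕ) (v : Fin (N + 1) → ℝ) (Q : Matrix (idx N) (idx N) ℝ) :
    quadValue N v Q = ∑ m : idx N, ∑ n : idx N, evenEmbed N v m * evenEmbed N v n * Q m n := by
  unfold quadValue dotProduct Matrix.mulVec dotProduct
  refine Finset.sum_congr rfl fun m _ ↦ ?_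
  rw [Finset.mul_sum]
  refine Finset.sum_congr rfl fun n _ ↦ ?_
  ring

/-- `K_v` is continuous. [cite: Groskin2026, §2.1 (p. 3)] -/
theorem continuous_volterraKernel (N : ℕ) (v : Fin (N + 1) → ℝ) : Continuous (volterraKernel N v) := by
  unfold volterraKernel
  have hT : Continuous (trigPoly N v) := by unfold trigPoly; fun_prop
  refine continuous_const.mul ?_
  have hf : Continuous (Function.uncurry fun (ω t : ℝ) ↦ trigPoly N v t * trigPoly N v (ω - t)) :=
    (hT.comp continuous_snd).mul (hT.comp (continuous_fst.sub continuous_snd))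
  exact intervalIntegral.continuous_parametric_intervalIntegral_of_continuous (a₀ := 0) hf continuous_id

/-! ### A continuous superposition of single-frequency sources (pole and archimedean sources) -/

/-- **`⟨v, Q_ψ v⟩ = ∫₀^L π a(y) K_v(1 − y/L) dy` for the superposition
`ψ(x) = ∫₀^L a(y) sin(2π(1 − y/L)x) dy`** of single-frequency sources with a continuous weight `a`
(Lemma 2.3 "applied inside the integral": the off-diagonal divided differences commute with `∫₀^L`
by linearity, the diagonal `ψ′(m)` by differentiation under the integral sign, and the finite double
sum `Σ u_m u_n` by linearity). [cite: Groskin2026, Theorem 2.5 proof (p. 6)] -/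
theorem quadValue_dividedDiffMatrix_sinIntegral {L : ℝ} (hL : 0 < L) {a : ℝ → ℝ} (ha : Continuous a)
    (N : ℕ) (v : Fin (N + 1) → ℝ) :
    ((quadValue N v (dividedDiffMatrix
        (fun x ↦ ∫ y in (0 : ℝ)..L, a y * Real.sin (2 * π * (1 - y / L) * x)) N) : ℝ) : ℂ) =
      ∫ y in (0 : ℝ)..L, ((π * a y : ℝ) : ℂ) * volterraKernel N v (1 - y / L) := by
  have hπ : (π : ℝ) ≠ 0 := Real.pi_ne_zero
  -- the entries of `Q_ψ` are the integrals of the entries of the single-frequency matrices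
  have hentry : ∀ m n : idx N,
      dividedDiffMatrix (fun x ↦ ∫ y in (0 : ℝ)..L, a y * Real.sin (2 * π * (1 - y / L) * x)) N m n =
        ∫ y in (0 : ℝ)..L,
          dividedDiffMatrix (fun x ↦ (π * a y) / π * Real.sin (2 * π * (1 - y / L) * x)) N m n := by
    intro m n
    simp_rw [dividedDiffMatrix_singleFreq_apply]
    by_cases h : (m : ℤ) = n
    · -- diagonal: differentiation under the integral sign
      simp only [if_pos h]
      have hderiv : HasDerivAt (fun x ↦ ∫ y in (0 : ℝ)..L, a y * Real.sin (2 * π * (1 - y / L) * x))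
          (∫ y in (0 : ℝ)..L, a y * (2 * π * (1 - y / L)) * Real.cos (2 * π * (1 - y / L) * ((m : ℤ) : ℝ)))
          ((m : ℤ) : ℝ) := by
        have key := intervalIntegral.hasDerivAt_integral_of_dominated_loc_of_deriv_le
          (𝕜 := ℝ) (μ := volume) (a := 0) (b := L) (x₀ := ((m : ℤ) : ℝ)) (s := univ)
          (F := fun x y ↦ a y * Real.sin (2 * π * (1 - y / L) * x))
          (F' := fun x y ↦ a y * (2 * π * (1 - y / L)) * Real.cos (2 * π * (1 - y / L) * x))
          (bound := fun y ↦ |a y| * (2 * π * (1 + |y| / L)))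
          Filter.univ_mem
          (Filter.Eventually.of_forall fun x ↦ (Continuous.aestronglyMeasurable (by fun_prop)))
          ((Continuous.intervalIntegrable (by fun_prop)) _ _)
          (Continuous.aestronglyMeasurable (by fun_prop))
          (Filter.Eventually.of_forall fun y _ x _ ↦ by
            rw [Real.norm_eq_abs, abs_mul, abs_mul]
            have h1 : |Real.cos (2 * π * (1 - y / L) * x)| ≤ 1 := Real.abs_cos_le_one _
            have h2 : |2 * π * (1 - y / L)| ≤ 2 * π * (1 + |y| / L) := by
              rw [abs_mul, abs_of_pos (by positivity : (0:ℝ) < 2 * π)]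
              refine mul_le_mul_of_nonneg_left ?_ (by positivity)
              calc |1 - y / L| ≤ |(1:ℝ)| + |y / L| := abs_sub _ _
                _ = 1 + |y| / L := by rw [abs_one, abs_div, abs_of_pos hL]
            have h0 : 0 ≤ |a y| := abs_nonneg _
            calc |a y| * |2 * π * (1 - y / L)| * |Real.cos (2 * π * (1 - y / L) * x)|
                ≤ |a y| * (2 * π * (1 + |y| / L)) * 1 :=
                  mul_le_mul (mul_le_mul_of_nonneg_left h2 h0) h1 (abs_nonneg _) (by positivity)
              _ = |a y| * (2 * π * (1 + |y| / L)) := mul_one _)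
          ((Continuous.intervalIntegrable (by fun_prop)) _ _)
          (Filter.Eventually.of_forall fun y _ x _ ↦ by
            have h1 : HasDerivAt (fun x : ℝ ↦ 2 * π * (1 - y / L) * x) (2 * π * (1 - y / L)) x := by
              simpa using (hasDerivAt_id x).const_mul (2 * π * (1 - y / L))
            have h2 := ((Real.hasDerivAt_sin _).comp x h1).const_mul (a y)
            exact h2.congr_deriv (by ring))
        exact key.2
      unfold dividedDiffMatrix
      simp only [Matrix.of_apply, if_pos h]
      rw [hderiv.deriv]
      refine intervalIntegral.integral_congr fun y _ ↦ ?_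
      field_simp
    · simp only [if_neg h]
      unfold dividedDiffMatrix
      simp only [Matrix.of_apply, if_neg h]
      rw [← intervalIntegral.integral_sub ((Continuous.intervalIntegrable (by fun_prop)) _ _)
        ((Continuous.intervalIntegrable (by fun_prop)) _ _), ← intervalIntegral.integral_div]
      refine intervalIntegral.integral_congr fun y _ ↦ ?_
      field_simp
  -- continuity of the single-frequency entries in `y`
  have hEcont : ∀ m n : idx N, Continuous fun y ↦
      dividedDiffMatrix (fun x ↦ (π * a y) / π * Real.sin (2 * π * (1 - y / L) * x)) N m n := by
    intro m n
    simp only [dividedDiffMatrix_singleFreq_apply]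
    by_cases h : (m : ℤ) = n
    · simp only [if_pos h]; fun_prop
    · simp only [if_neg h]; fun_prop
  -- the quadratic value as the integral of the quadratic values
  have hquad : quadValue N v (dividedDiffMatrix
      (fun x ↦ ∫ y in (0 : ℝ)..L, a y * Real.sin (2 * π * (1 - y / L) * x)) N) =
      ∫ y in (0 : ℝ)..L, quadValue N v
        (dividedDiffMatrix (fun x ↦ (π * a y) / π * Real.sin (2 * π * (1 - y / L) * x)) N) := by
    simp_rw [quadValue_eq_sum']
    have hint : ∀ m n : idx N, IntervalIntegrable (fun y ↦ evenEmbed N v m * evenEmbed N v n *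
        dividedDiffMatrix (fun x ↦ (π * a y) / π * Real.sin (2 * π * (1 - y / L) * x)) N m n)
        volume 0 L := fun m n ↦
      (continuous_const.mul (hEcont m n)).intervalIntegrable _ _
    have step1 : ∫ y in (0 : ℝ)..L, ∑ m : idx N, ∑ n : idx N, evenEmbed N v m * evenEmbed N v n *
        dividedDiffMatrix (fun x ↦ (π * a y) / π * Real.sin (2 * π * (1 - y / L) * x)) N m n =
        ∑ m : idx N, ∫ y in (0 : ℝ)..L, ∑ n : idx N, evenEmbed N v m * evenEmbed N v n *
          dividedDiffMatrix (fun x ↦ (π * a y) / π * Real.sin (2 * π * (1 - y / L) * x)) N m n :=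
      intervalIntegral.integral_finsetSum (f := fun m y ↦ ∑ n : idx N, evenEmbed N v m * evenEmbed N v n *
        dividedDiffMatrix (fun x ↦ (π * a y) / π * Real.sin (2 * π * (1 - y / L) * x)) N m n)
        (fun m _ ↦ (continuous_finsetSum _ fun n _ ↦ continuous_const.mul (hEcont m n)).intervalIntegrable _ _)
    have step2 : ∀ m : idx N, ∫ y in (0 : ℝ)..L, ∑ n : idx N, evenEmbed N v m * evenEmbed N v n *
        dividedDiffMatrix (fun x ↦ (π * a y) / π * Real.sin (2 * π * (1 - y / L) * x)) N m n =
        ∑ n : idx N, ∫ y in (0 : ℝ)..L, evenEmbed N v m * evenEmbed N v n *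
          dividedDiffMatrix (fun x ↦ (π * a y) / π * Real.sin (2 * π * (1 - y / L) * x)) N m n :=
      fun m ↦ intervalIntegral.integral_finsetSum (f := fun n y ↦ evenEmbed N v m * evenEmbed N v n *
        dividedDiffMatrix (fun x ↦ (π * a y) / π * Real.sin (2 * π * (1 - y / L) * x)) N m n)
        (fun n _ ↦ hint m n)
    rw [step1]
    refine Finset.sum_congr rfl fun m _ ↦ ?_
    rw [step2]
    refine Finset.sum_congr rfl fun n _ ↦ ?_
    rw [hentry, intervalIntegral.integral_const_mul]
  rw [hquad, ← intervalIntegral.integral_ofReal]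
  refine intervalIntegral.integral_congr fun y _ ↦ ?_
  exact lemma_2_3_holds N v (π * a y) (1 - y / L)

/-! ### Stage Q: the pole side -/

/-- The pole source (2) as a continuous superposition of single-frequency sources with weight
`a(y) = 2cosh(y/2)/π` ("whose measure is the push-forward of `2cosh(y/2) dy` under `ω = 1 − y/L`").
[cite: Groskin2026, Theorem 2.5 proof (p. 6)] -/
theorem poleSource_eq_sinIntegral (c : ℝ) :
    poleSource c = fun x ↦ ∫ y in (0 : ℝ)..Real.log c,
      (2 * Real.cosh (y / 2) / π) * Real.sin (2 * π * (1 - y / Real.log c) * x) := by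
  funext x
  rw [poleSource, ← intervalIntegral.integral_const_mul]
  refine intervalIntegral.integral_congr fun y _ ↦ ?_
  rw [show 2 * π * x * (1 - y / Real.log c) = 2 * π * (1 - y / Real.log c) * x by ring]
  ring

/-- **`⟨v, Q_pole v⟩ = ∫₀^L 2cosh(y/2) K_v(1 − y/L) dy`** (Lemma 2.3 applied to the pole source).
[cite: Groskin2026, Theorem 2.5 proof (p. 6), second display] -/
theorem quadValue_poleMatrix_eq_integral (c : ℝ) (hc : 1 < c) (N : ℕ) (v : Fin (N + 1) → ℝ) :
    ((quadValue N v (poleMatrix c N) : ℝ) : ℂ) =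
      ∫ y in (0 : ℝ)..Real.log c,
        ((2 * Real.cosh (y / 2) : ℝ) : ℂ) * volterraKernel N v (1 - y / Real.log c) := by
  have hL : 0 < Real.log c := Real.log_pos hc
  rw [poleMatrix, poleSource_eq_sinIntegral,
    quadValue_dividedDiffMatrix_sinIntegral hL (by fun_prop) N v]
  refine intervalIntegral.integral_congr fun y _ ↦ ?_
  congr 2
  field_simp

/-- On the band, `ĝ_v(ξ) e^{2πi(i/2)ξ} = π K_v(1 − |ξ|/Δ) e^{−πξ}`. [cite: Groskin2026, Theorem 2.5 proof (p. 6)] -/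
theorem fourierWeight_mul_cexp_I_half (c : ℝ) (N : ℕ) (v : Fin (N + 1) → ℝ) {ξ : ℝ}
    (hξ : |ξ| ≤ bandwidth c) :
    fourierWeight c N v ξ * cexp (2 * π * I * (I / 2) * ξ) =
      π * volterraKernel N v (1 - |ξ| / bandwidth c) * cexp (-(π * ξ)) := by
  rw [fourierWeight, if_pos hξ]
  have : (2 : ℂ) * π * I * (I / 2) * ξ = -(π * ξ) := by
    have hI : I * I = -1 := Complex.I_mul_I
    linear_combination (π * ξ) * hI
  rw [this]

/-- The pole-side integrand after the substitution `ξ = y/2π` (`πΔ = L/2`, evenness of `ĝ_v`,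
`e^{−y/2} + e^{y/2} = 2cosh(y/2)`), for `0 ≤ y`. [cite: Groskin2026, Theorem 2.5 proof (p. 6)] -/
theorem pole_integrand_eq (c : ℝ) (hc : 1 < c) (N : ℕ) (v : Fin (N + 1) → ℝ) {y : ℝ} (hy : 0 ≤ y) :
    (π : ℂ)⁻¹ * (π * volterraKernel N v (1 - |y / (2 * π)| / bandwidth c) *
        (cexp (-(π * (y / (2 * π) : ℝ))) + cexp (π * (y / (2 * π) : ℝ)))) =
      ((2 * Real.cosh (y / 2) : ℝ) : ℂ) * volterraKernel N v (1 - y / Real.log c) := by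
  have hL : 0 < Real.log c := Real.log_pos hc
  have hπ : (π : ℝ) ≠ 0 := Real.pi_ne_zero
  have hπC : (π : ℂ) ≠ 0 := by exact_mod_cast hπ
  have h1 : 1 - |y / (2 * π)| / bandwidth c = 1 - y / Real.log c := by
    rw [abs_of_nonneg (by positivity), bandwidth]
    field_simp
  have h2 : cexp (-(π * (y / (2 * π) : ℝ))) + cexp (π * (y / (2 * π) : ℝ)) =
      ((2 * Real.cosh (y / 2) : ℝ) : ℂ) := by
    have h3 : (π : ℂ) * ((y / (2 * π) : ℝ) : ℂ) = ((y / 2 : ℝ) : ℂ) := by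
      push_cast
      field_simp
    rw [h3]
    push_cast
    rw [Complex.two_cosh]
    ring_nf
  rw [h1, h2]
  field_simp

/-- **`2 g_v(i/2) = ∫₀^L 2cosh(y/2) K_v(1 − y/L) dy`** ("the substitution `ξ = Δ(1 − ω)` together with
`πΔ = L/2`, `ĝ_v(ξ) = πK_v(1 − ξ/Δ)`, the evenness of `ĝ_v` (which converts `2cosh(πξ)` into `2e^{−πξ}`
under the integral), and `e^{2πi(i/2)ξ} = e^{−πξ}`"). [cite: Groskin2026, Theorem 2.5 proof (p. 6)] -/
theorem two_mul_testFunction_I_half (c : ℝ) (hc : 1 < c) (N : ℕ) (v : Fin (N + 1) → ℝ) :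
    2 * testFunction c N v (I / 2) =
      ∫ y in (0 : ℝ)..Real.log c,
        ((2 * Real.cosh (y / 2) : ℝ) : ℂ) * volterraKernel N v (1 - y / Real.log c) := by
  have hL : 0 < Real.log c := Real.log_pos hc
  have hΔ : 0 < bandwidth c := by rw [bandwidth]; positivity
  have hπ : (π : ℝ) ≠ 0 := Real.pi_ne_zero
  have h2π : (2 * π : ℝ) ≠ 0 := by positivity
  set Δ := bandwidth c with hΔdef
  -- the even band profile and the folded integrand
  set K : ℝ → ℂ := fun ξ ↦ π * volterraKernel N v (1 - |ξ| / Δ) with hK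
  set F : ℝ → ℂ := fun ξ ↦ K ξ * (cexp (-(π * ξ)) + cexp (π * ξ)) with hF
  have hKcont : Continuous K :=
    continuous_const.mul ((continuous_volterraKernel N v).comp (by fun_prop))
  have hKeven : ∀ ξ, K (-ξ) = K ξ := by intro ξ; simp [hK]
  have hint : ∀ a b : ℝ, IntervalIntegrable (fun ξ ↦ K ξ * cexp (-(π * ξ))) volume a b := fun a b ↦
    (hKcont.mul (by fun_prop)).intervalIntegrable _ _
  have hint' : ∀ a b : ℝ, IntervalIntegrable (fun ξ ↦ K ξ * cexp (π * ξ)) volume a b := fun a b ↦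
    (hKcont.mul (by fun_prop)).intervalIntegrable _ _
  -- Step 1: the band integral with `e^{−πξ}`
  have h1 : testFunction c N v (I / 2) = ∫ ξ in (-Δ)..Δ, K ξ * cexp (-(π * ξ)) := by
    rw [testFunction]
    refine intervalIntegral.integral_congr fun ξ hξ ↦ ?_
    rw [Set.uIcc_of_le (by linarith), Set.mem_Icc] at hξ
    exact fourierWeight_mul_cexp_I_half c N v (abs_le.2 ⟨hξ.1, hξ.2⟩)
  -- Step 2: fold onto `[0, Δ]` by evenness
  have h2 : ∫ ξ in (-Δ)..Δ, K ξ * cexp (-(π * ξ)) = ∫ ξ in (0:ℝ)..Δ, F ξ := by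
    rw [← intervalIntegral.integral_add_adjacent_intervals (hint (-Δ) 0) (hint 0 Δ)]
    have hneg : ∫ ξ in (-Δ)..0, K ξ * cexp (-(π * ξ)) = ∫ ξ in (0:ℝ)..Δ, K ξ * cexp (π * ξ) := by
      have := intervalIntegral.integral_comp_neg (a := 0) (b := Δ) (fun ξ ↦ K ξ * cexp (-(π * ξ)))
      rw [neg_zero] at this
      rw [← this]
      refine intervalIntegral.integral_congr fun ξ _ ↦ ?_
      simp only [hKeven]
      push_cast
      ring_nf
    rw [hneg, ← intervalIntegral.integral_add (hint' 0 Δ) (hint 0 Δ)]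
    refine intervalIntegral.integral_congr fun ξ _ ↦ ?_
    simp only [hF]
    ring
  -- Step 3: substitution `ξ = y/(2π)`
  have h3 : ∫ ξ in (0:ℝ)..Δ, F ξ = ((2 * π)⁻¹ : ℝ) * ∫ y in (0:ℝ)..Real.log c, F (y / (2 * π)) := by
    have key := intervalIntegral.integral_comp_mul_left (a := 0) (b := Real.log c) F (inv_ne_zero h2π)
    have hb : (2 * π)⁻¹ * Real.log c = Δ := by rw [hΔdef, bandwidth]; field_simp
    rw [mul_zero, hb, inv_inv, Complex.real_smul] at key
    have hFdiv : (fun y : ℝ ↦ F (y / (2 * π))) = fun y ↦ F ((2 * π)⁻¹ * y) := by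
      funext y; rw [div_eq_inv_mul]
    rw [hFdiv, key, ← mul_assoc]
    have : (((2 * π)⁻¹ : ℝ) : ℂ) * ((2 * π : ℝ) : ℂ) = 1 := by
      rw [← Complex.ofReal_mul, inv_mul_cancel₀ h2π]; simp
    rw [this, one_mul]
  -- Step 4: assemble and identify the integrand on `[0, L]`
  rw [h1, h2, h3, ← mul_assoc]
  have hcoef : (2 : ℂ) * (((2 * π)⁻¹ : ℝ) : ℂ) = (π : ℂ)⁻¹ := by
    push_cast
    field_simp
  rw [hcoef, ← intervalIntegral.integral_const_mul]
  refine intervalIntegral.integral_congr fun y hy ↦ ?_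
  rw [Set.uIcc_of_le hL.le, Set.mem_Icc] at hy
  simp only [hF, hK]
  have := pole_integrand_eq c hc N v hy.1
  push_cast at this ⊢
  exact this

/-- **The pole side of Theorem 2.5: `⟨v, Q_pole v⟩ = 2 g_v(i/2)`.**
[cite: Groskin2026, Theorem 2.5 proof (p. 6), second display] -/
theorem quadValue_poleMatrix (c : ℝ) (hc : 1 < c) (N : ℕ) (v : Fin (N + 1) → ℝ) :
    ((quadValue N v (poleMatrix c N) : ℝ) : ℂ) = 2 * testFunction c N v (I / 2) := by
  rw [quadValue_poleMatrix_eq_integral c hc, two_mul_testFunction_I_half c hc]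

end Groskin2026

end Literature.NumberTheory.LFunctions

end
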